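import Literature.Probability.RandomPlanarGeometry.HexSAWBrickWallSlabFugacitySymmetric
import HarnessLib

/-!
# Beaton 2014 Proposition 8 with BOTH surface fugacities on the armchair slabs: `μ_H(y,z)` exists, `μ_H(y,z) = μ_H(z,y)`

Topic `Literature/Probability/RandomPlanarGeometry` (continues `HexSAWBrickWallSlabFugacitySymmetric.lean` — the
two-fugacity partition function `HexBW.slabZ₂ H n y z = Ĉ_{H,n}(y,z)` of the armchair slab `Slab_H = {0 ≤ x₀ ≤ H}` over
translation classes (weights on the two boundary columns: `HexBW.leftVisits`, `HexBW.rightVisits H`) and its exact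
symmetry `slabZ₂_symm` — and `HexSAWBrickWallSlabFugacity.lean`: the one-variable case `slabZ`, `slabMuY`, the split
`slabSplit`, `leftVisits_split`).  Source: N. R. Beaton, *The critical surface fugacity of self-avoiding walks on a rotated
honeycomb lattice*, J. Phys. A 47 (2014) 075003, arXiv:1210.0274v3, §3.2, Proposition 8 (p. 15): "For `y, z > 0`,
`lim Â_{T,n}(y,z)^{1/n} = lim B̂_{T,n}(y,z)^{1/n} = lim Ĉ_{T,n}(y,z)^{1/n} =: μ_T(y,z)`, where `μ_T(y,z)` is finite and
non-decreasing in `y` and `z`. We also have `μ_T(y,z) = μ_T(z,y)`" (printed by reference to BBdGDCG 2014 Proposition 6).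
Here, for the `Ĉ`-limit over translation classes (slabs `H ≥ 1`): weighted sub-multiplicativity (the split vertex is
counted twice in each weight, costing `max(1,y⁻¹) · max(1,z⁻¹)`), Fekete's lemma (Madras–Slade Lemma 1.2.2 p. 9 with
§8.2 (8.2.2)–(8.2.3) p. 267), and the exact symmetry of the previous file.  The arch/bridge limits and the
monotonicity in `(y,z)` are not treated here.

## Statements (namespace `Literature.Probability.RandomPlanarGeometry.SAW.HexBW`, all PROVED, standard axioms)

* `rightVisits_le`, `rightVisits_split`, `slabZ₂_pos`, `min_pow_le_slabZ₂` (`H ≥ 1`);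
* **`slabZ₂_add_le`** — `Ĉ_{H,N+M}(y,z) ≤ max(1,y⁻¹) max(1,z⁻¹) · Ĉ_{H,N}(y,z) · Ĉ_{H,M}(y,z)`;
* `slabMuY₂ H y z = μ_H(y,z) := inf_N (max(1,y⁻¹) max(1,z⁻¹) Ĉ_{H,N}(y,z))^{1/N}`, `slabMuY₂_le_rpow`,
  **`tendsto_slabZ₂_rpow`** (`Ĉ_{H,n}(y,z)^{1/n} → μ_H(y,z)`, `H ≥ 1`), `slabMuY₂_pos`;
* **`slabMuY₂_symm : μ_H(y,z) = μ_H(z,y)`**, `slabMuY₂_one_right : μ_H(y,1) = HexBW.slabMuY H y`,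
  `slabMuY₂_one_left : μ_H(1,z) = HexBW.slabMuY H z`.
-/

noncomputable section

open Filter Topology Finset Literature.Probability.LatticeModels Literature.Probability.Percolation SimpleGraph

namespace Literature.Probability.RandomPlanarGeometry.SAW.HexBW

/-! ### Bookkeeping for the right count -/

/-- `rightVisits ≤ n + 1`. [cite: Beaton2014RotatedHoneycomb, §3.2, Proposition 8 (arXiv:1210.0274v3 p. 15)] -/
theorem rightVisits_le (H : ℕ) (a : Site 2) (υ : ℕ → Site 2) (n : ℕ) : rightVisits H a υ n ≤ n + 1 := by
  unfold rightVisits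
  calc ∑ m ∈ Finset.range (n + 1), (if (a + υ m) 0 = (H : ℤ) then 1 else 0)
      ≤ ∑ _m ∈ Finset.range (n + 1), 1 := Finset.sum_le_sum fun m _ => by split_ifs <;> omega
    _ = n + 1 := by simp

/-- The right-column vertices of a walk are those of its two halves, the split vertex (if it is one) counted twice
(the re-normalising translation of `HexBW.slabSplit` is vertical, so it preserves the column test).
[cite: Beaton2014RotatedHoneycomb, §3.2, Proposition 8 (arXiv:1210.0274v3 p. 15: concatenation)] -/
theorem rightVisits_split (H : ℕ) (a : Site 2) (ω : ℕ → Site 2) (N M : ℕ) :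
    rightVisits H a ω (N + M) + (if (a + ω N) 0 = (H : ℤ) then 1 else 0) =
      rightVisits H (slabSplit N M (a, ω)).1.1 (slabSplit N M (a, ω)).1.2 N +
        rightVisits H (slabSplit N M (a, ω)).2.1 (slabSplit N M (a, ω)).2.2 M := by
  unfold rightVisits slabSplit
  simp only
  have e1 : ∑ m ∈ Finset.range (N + 1), (if (a + ω (min m N)) 0 = (H : ℤ) then 1 else 0) =
      ∑ m ∈ Finset.range (N + 1), (if (a + ω m) 0 = (H : ℤ) then 1 else 0) :=
    Finset.sum_congr rfl fun m hm => by rw [min_eq_left (Nat.lt_succ_iff.1 (Finset.mem_range.1 hm))]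
  have e2 : ∑ m ∈ Finset.range (M + 1),
      (if (vnorm (a + ω N) + (ω (N + min m M) - ω N)) 0 = (H : ℤ) then 1 else 0) =
      ∑ m ∈ Finset.range (M + 1), (if (a + ω (N + m)) 0 = (H : ℤ) then 1 else 0) :=
    Finset.sum_congr rfl fun m hm => by
      rw [min_eq_left (Nat.lt_succ_iff.1 (Finset.mem_range.1 hm))]
      have h0 : (vnorm (a + ω N) + (ω (N + m) - ω N)) 0 = (a + ω (N + m)) 0 := by
        simp only [Pi.add_apply, Pi.sub_apply, vnorm_apply_zero]; ring
      rw [h0]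
  rw [e1, e2, show N + M + 1 = (N + 1) + M by ring, Finset.sum_range_add, Finset.sum_range_succ' (n := M)]
  simp only [add_zero]
  have e3 : ∀ m, N + 1 + m = N + (m + 1) := fun m => by ring
  simp only [e3]
  ring

/-! ### Positivity and a crude lower bound -/

/-- `0 < Ĉ_{H,n}(y,z)` for `y, z > 0`, `H ≥ 1`. [cite: Beaton2014RotatedHoneycomb, §3.2, Proposition 8 (arXiv:1210.0274v3 p. 15)] -/
theorem slabZ₂_pos {H : ℕ} (hH : 1 ≤ H) (n : ℕ) {y z : ℝ} (hy : 0 < y) (hz : 0 < z) : 0 < slabZ₂ H n y z := by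
  unfold slabZ₂
  have hne : (slabPairs H n).Nonempty := Finset.card_pos.1 (one_le_slabCount hH n)
  exact Finset.sum_pos (fun p _ => mul_pos (pow_pos hy _) (pow_pos hz _)) hne

/-- `(min(1,y) min(1,z))^{n+1} ≤ Ĉ_{H,n}(y,z)` for `H ≥ 1`. [cite: Beaton2014RotatedHoneycomb, §3.2, Proposition 8 (arXiv:1210.0274v3 p. 15)] -/
theorem min_pow_le_slabZ₂ {H : ℕ} (hH : 1 ≤ H) (n : ℕ) {y z : ℝ} (hy : 0 < y) (hz : 0 < z) :
    (min 1 y * min 1 z) ^ (n + 1) ≤ slabZ₂ H n y z := by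
  have hne : (slabPairs H n).Nonempty := Finset.card_pos.1 (one_le_slabCount hH n)
  obtain ⟨p, hp⟩ := hne
  have hmz : 0 ≤ min 1 z := le_min zero_le_one hz.le
  have hby : (min 1 y) ^ (n + 1) ≤ y ^ leftVisits p.1 p.2 n := by
    have hb := leftVisits_le p.1 p.2 n
    rcases le_or_gt 1 y with h1 | h1
    · rw [min_eq_left h1, one_pow]; exact one_le_pow₀ h1
    · rw [min_eq_right h1.le]; exact pow_le_pow_of_le_one hy.le h1.le hb
  have htz : (min 1 z) ^ (n + 1) ≤ z ^ rightVisits H p.1 p.2 n := by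
    have ht := rightVisits_le H p.1 p.2 n
    rcases le_or_gt 1 z with h1 | h1
    · rw [min_eq_left h1, one_pow]; exact one_le_pow₀ h1
    · rw [min_eq_right h1.le]; exact pow_le_pow_of_le_one hz.le h1.le ht
  unfold slabZ₂
  calc (min 1 y * min 1 z) ^ (n + 1) = (min 1 y) ^ (n + 1) * (min 1 z) ^ (n + 1) := mul_pow _ _ _
    _ ≤ y ^ leftVisits p.1 p.2 n * z ^ rightVisits H p.1 p.2 n :=
        mul_le_mul hby htz (pow_nonneg hmz _) (pow_nonneg hy.le _)
    _ ≤ ∑ q ∈ slabPairs H n, y ^ leftVisits q.1 q.2 n * z ^ rightVisits H q.1 q.2 n :=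
        Finset.single_le_sum (f := fun q => y ^ leftVisits q.1 q.2 n * z ^ rightVisits H q.1 q.2 n)
          (fun q _ => mul_nonneg (pow_nonneg hy.le _) (pow_nonneg hz.le _)) hp

/-! ### Submultiplicativity with both weights -/

/-- One weight across a split: if `b + i = b₁ + b₂` with `i ≤ 1` then `y^b ≤ max(1,y⁻¹) · y^{b₁} y^{b₂}`.
[cite: Beaton2014RotatedHoneycomb, §3.2, Proposition 8 (arXiv:1210.0274v3 p. 15: concatenation)] -/
private theorem pow_le_yK_mul_of_split' {y : ℝ} (hy : 0 < y) {b b₁ b₂ i : ℕ} (hi : i ≤ 1) (e : b + i = b₁ + b₂) :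
    y ^ b ≤ yK y * (y ^ b₁ * y ^ b₂) := by
  rw [← pow_add, ← e, pow_add]
  interval_cases i
  · rw [pow_zero, mul_one]
    calc y ^ b = 1 * y ^ b := (one_mul _).symm
      _ ≤ yK y * y ^ b := mul_le_mul_of_nonneg_right (one_le_yK y) (by positivity)
  · rw [pow_one]
    calc y ^ b = y⁻¹ * (y ^ b * y) := by field_simp
      _ ≤ yK y * (y ^ b * y) := mul_le_mul_of_nonneg_right (inv_le_yK y) (by positivity)

/-- **Submultiplicativity with both boundary weights**:
`Ĉ_{H,N+M}(y,z) ≤ max(1,y⁻¹) max(1,z⁻¹) · Ĉ_{H,N}(y,z) · Ĉ_{H,M}(y,z)`.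
[cite: MadrasSlade1993, §8.2, (8.2.2)–(8.2.3) (p. 267) and Lemma 1.2.2 (p. 9) — weighted form]
[cite: Beaton2014RotatedHoneycomb, §3.2, Proposition 8 (arXiv:1210.0274v3 p. 15: existence by concatenation)] -/
theorem slabZ₂_add_le (H N M : ℕ) {y z : ℝ} (hy : 0 < y) (hz : 0 < z) :
    slabZ₂ H (N + M) y z ≤ yK y * yK z * slabZ₂ H N y z * slabZ₂ H M y z := by
  classical
  have hKy := one_le_yK y
  have hKz := one_le_yK z
  set w : ℕ → Site 2 × (ℕ → Site 2) → ℝ := fun n q => y ^ leftVisits q.1 q.2 n * z ^ rightVisits H q.1 q.2 n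
    with hw
  have hpt : ∀ p ∈ slabPairs H (N + M), w (N + M) p ≤
      yK y * yK z * (w N (slabSplit N M p).1 * w M (slabSplit N M p).2) := by
    rintro ⟨a, ω⟩ -
    have eb := leftVisits_split a ω N M
    have et := rightVisits_split H a ω N M
    have hb := pow_le_yK_mul_of_split' hy (b := leftVisits a ω (N + M))
      (i := if (a + ω N) 0 = 0 then 1 else 0) (by split_ifs <;> omega) eb
    have ht := pow_le_yK_mul_of_split' hz (b := rightVisits H a ω (N + M))
      (i := if (a + ω N) 0 = (H : ℤ) then 1 else 0) (by split_ifs <;> omega) et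
    simp only [hw]
    calc y ^ leftVisits a ω (N + M) * z ^ rightVisits H a ω (N + M)
        ≤ (yK y * (y ^ leftVisits (slabSplit N M (a, ω)).1.1 (slabSplit N M (a, ω)).1.2 N *
            y ^ leftVisits (slabSplit N M (a, ω)).2.1 (slabSplit N M (a, ω)).2.2 M)) *
          (yK z * (z ^ rightVisits H (slabSplit N M (a, ω)).1.1 (slabSplit N M (a, ω)).1.2 N *
            z ^ rightVisits H (slabSplit N M (a, ω)).2.1 (slabSplit N M (a, ω)).2.2 M)) :=
          mul_le_mul hb ht (by positivity) (by positivity)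
      _ = _ := by ring
  have hnn : ∀ q ∈ slabPairs H N ×ˢ slabPairs H M, 0 ≤ w N q.1 * w M q.2 := fun q _ => by
    simp only [hw]; positivity
  calc slabZ₂ H (N + M) y z
      = ∑ p ∈ slabPairs H (N + M), w (N + M) p := rfl
    _ ≤ ∑ p ∈ slabPairs H (N + M), yK y * yK z * (w N (slabSplit N M p).1 * w M (slabSplit N M p).2) :=
        Finset.sum_le_sum hpt
    _ = yK y * yK z * ∑ q ∈ (slabPairs H (N + M)).image (slabSplit N M), w N q.1 * w M q.2 := by
        rw [Finset.mul_sum, Finset.sum_image (slabSplit_injOn H N M)]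
    _ ≤ yK y * yK z * ∑ q ∈ slabPairs H N ×ˢ slabPairs H M, w N q.1 * w M q.2 := by
        refine mul_le_mul_of_nonneg_left (Finset.sum_le_sum_of_subset_of_nonneg
          (fun q hq => ?_) fun q hq _ => hnn q hq) (by nlinarith)
        obtain ⟨p, hp, rfl⟩ := Finset.mem_image.1 hq
        exact slabSplit_mem hp
    _ = yK y * yK z * (slabZ₂ H N y z * slabZ₂ H M y z) := by
        rw [Finset.sum_product, slabZ₂, slabZ₂, Finset.sum_mul_sum]
    _ = yK y * yK z * slabZ₂ H N y z * slabZ₂ H M y z := by ring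

/-! ### The growth rate `μ_H(y,z)` (Proposition 8, existence) and its symmetry -/

/-- **`μ_H(y,z) := inf_N (max(1,y⁻¹) max(1,z⁻¹) Ĉ_{H,N}(y,z))^{1/N}`** (equal to `lim Ĉ_{H,N}(y,z)^{1/N}`,
`tendsto_slabZ₂_rpow`). [cite: Beaton2014RotatedHoneycomb, §3.2, Proposition 8 (arXiv:1210.0274v3 p. 15: μ_T(y,z) := lim Ĉ_{T,n}(y,z)^{1/n})] -/
def slabMuY₂ (H : ℕ) (y z : ℝ) : ℝ := ⨅ n : ℕ, (yK y * yK z * slabZ₂ H (n + 1) y z) ^ (1 / ((n : ℝ) + 1))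

/-- `μ_H(y,z) ≤ (max(1,y⁻¹) max(1,z⁻¹) Ĉ_{H,n}(y,z))^{1/n}` for `n ≥ 1`. [cite: Beaton2014RotatedHoneycomb, §3.2, Proposition 8 (arXiv:1210.0274v3 p. 15)] -/
theorem slabMuY₂_le_rpow {H : ℕ} (hH : 1 ≤ H) {y z : ℝ} (hy : 0 < y) (hz : 0 < z) {n : ℕ} (hn : n ≠ 0) :
    slabMuY₂ H y z ≤ (yK y * yK z * slabZ₂ H n y z) ^ (1 / (n : ℝ)) := by
  obtain ⟨m, rfl⟩ := Nat.exists_eq_succ_of_ne_zero hn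
  have hK : 0 ≤ yK y * yK z := mul_nonneg (by linarith [one_le_yK y]) (by linarith [one_le_yK z])
  have hb : BddBelow (Set.range fun m : ℕ => (yK y * yK z * slabZ₂ H (m + 1) y z) ^ (1 / ((m : ℝ) + 1))) :=
    ⟨0, by
      rintro _ ⟨m, rfl⟩
      exact Real.rpow_nonneg (mul_nonneg hK (slabZ₂_pos hH _ hy hz).le) _⟩
  have := ciInf_le hb m
  simpa [slabMuY₂, Nat.cast_succ] using this

/-- **`Ĉ_{H,n}(y,z)^{1/n} → μ_H(y,z)`** (`H ≥ 1`) — Proposition 8, existence of the two-fugacity growth rate, by Fekete's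
lemma for `log(max(1,y⁻¹) max(1,z⁻¹) Ĉ_{H,n}(y,z))`, subadditive by `slabZ₂_add_le`.
[cite: Beaton2014RotatedHoneycomb, §3.2, Proposition 8 (arXiv:1210.0274v3 p. 15: lim Ĉ_{T,n}(y,z)^{1/n} =: μ_T(y,z))]
[cite: MadrasSlade1993, Lemma 1.2.2 (p. 9) with §8.2 (8.2.2)–(8.2.3) (p. 267)] -/
theorem tendsto_slabZ₂_rpow {H : ℕ} (hH : 1 ≤ H) {y z : ℝ} (hy : 0 < y) (hz : 0 < z) :
    Tendsto (fun n : ℕ => (slabZ₂ H n y z) ^ (1 / (n : ℝ))) atTop (𝓝 (slabMuY₂ H y z)) := by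
  set K : ℝ := yK y * yK z with hKdef
  have hK : 1 ≤ K := by
    rw [hKdef]; nlinarith [one_le_yK y, one_le_yK z]
  have hK0 : 0 < K := by linarith
  have hpos : ∀ n, 0 < K * slabZ₂ H n y z := fun n => mul_pos hK0 (slabZ₂_pos hH n hy hz)
  have hu : Subadditive fun n => Real.log (K * slabZ₂ H n y z) := by
    intro m n
    rw [← Real.log_mul (hpos m).ne' (hpos n).ne']
    apply Real.log_le_log (hpos _)
    have h := slabZ₂_add_le H m n hy hz
    rw [← hKdef] at h
    calc K * slabZ₂ H (m + n) y z ≤ K * (K * slabZ₂ H m y z * slabZ₂ H n y z) :=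
          mul_le_mul_of_nonneg_left h hK0.le
      _ = K * slabZ₂ H m y z * (K * slabZ₂ H n y z) := by ring
  set c : ℝ := min 1 y * min 1 z with hc
  have hc0 : 0 < c := mul_pos (lt_min one_pos hy) (lt_min one_pos hz)
  have hc1 : c ≤ 1 := by
    rw [hc]
    calc min 1 y * min 1 z ≤ 1 * 1 :=
          mul_le_mul (min_le_left _ _) (min_le_left _ _) (le_min zero_le_one hz.le) zero_le_one
      _ = 1 := one_mul 1
  have hbdd : BddBelow (Set.range fun n : ℕ => Real.log (K * slabZ₂ H n y z) / n) := by
    refine ⟨2 * Real.log c, ?_⟩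
    rintro _ ⟨n, rfl⟩
    have hlog0 : Real.log c ≤ 0 := Real.log_nonpos hc0.le hc1
    rcases Nat.eq_zero_or_pos n with rfl | hn
    · simp only [Nat.cast_zero, div_zero]; linarith
    · have h1 : c ^ (n + 1) ≤ K * slabZ₂ H n y z :=
        (min_pow_le_slabZ₂ hH n hy hz).trans (le_mul_of_one_le_left (slabZ₂_pos hH n hy hz).le hK)
      have h2 : ((n : ℝ) + 1) * Real.log c ≤ Real.log (K * slabZ₂ H n y z) := by
        have := Real.log_le_log (pow_pos hc0 _) h1
        rwa [Real.log_pow, Nat.cast_succ] at this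
      rw [le_div_iff₀ (by exact_mod_cast hn)]
      have hn1 : (1 : ℝ) ≤ n := by exact_mod_cast hn
      nlinarith
  have hlim := hu.tendsto_lim hbdd
  have hKlim : Tendsto (fun n : ℕ => K ^ (1 / (n : ℝ))) atTop (𝓝 1) := by
    have h1 : Tendsto (fun n : ℕ => Real.log K / (n : ℝ)) atTop (𝓝 0) :=
      tendsto_const_div_atTop_nhds_zero_nat _
    have h2 := (Real.continuous_exp.tendsto _).comp h1
    rw [Real.exp_zero] at h2
    refine h2.congr fun n => ?_
    rw [Function.comp_apply, Real.rpow_def_of_pos hK0, mul_one_div]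
  have key : ∀ n : ℕ, (K * slabZ₂ H n y z) ^ (1 / (n : ℝ)) = Real.exp (Real.log (K * slabZ₂ H n y z) / n) :=
    fun n => by rw [Real.rpow_def_of_pos (hpos n), mul_one_div]
  have hexp : Tendsto (fun n : ℕ => (K * slabZ₂ H n y z) ^ (1 / (n : ℝ))) atTop (𝓝 (Real.exp hu.lim)) := by
    rw [show (fun n : ℕ => (K * slabZ₂ H n y z) ^ (1 / (n : ℝ))) =
      fun n => Real.exp (Real.log (K * slabZ₂ H n y z) / n) from funext key]
    exact (Real.continuous_exp.tendsto _).comp hlim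
  have hid : Real.exp hu.lim = slabMuY₂ H y z := by
    apply le_antisymm
    · refine le_ciInf fun n => ?_
      have h1 := hu.lim_le_div hbdd (Nat.succ_ne_zero n)
      have h2 := Real.exp_le_exp.2 h1
      rw [← key (n + 1)] at h2
      simpa [Nat.cast_succ, hKdef] using h2
    · refine ge_of_tendsto hexp ?_
      filter_upwards [eventually_ge_atTop 1] with n hn
      rw [hKdef]
      exact slabMuY₂_le_rpow hH hy hz (by omega)
  have hprod : Tendsto (fun n : ℕ => K⁻¹ ^ (1 / (n : ℝ)) * (K * slabZ₂ H n y z) ^ (1 / (n : ℝ))) atTop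
      (𝓝 (slabMuY₂ H y z)) := by
    have h1 : Tendsto (fun n : ℕ => K⁻¹ ^ (1 / (n : ℝ))) atTop (𝓝 1) := by
      have := hKlim.inv₀ one_ne_zero
      rw [inv_one] at this
      refine this.congr fun n => ?_
      rw [Real.inv_rpow hK0.le]
    have := h1.mul hexp
    rwa [one_mul, hid] at this
  refine hprod.congr fun n => ?_
  rw [← Real.mul_rpow (inv_nonneg.2 hK0.le) (hpos n).le, ← mul_assoc, inv_mul_cancel₀ hK0.ne', one_mul]

/-- `0 < μ_H(y,z)` (indeed `≥ (min(1,y) min(1,z))²`), `H ≥ 1`. [cite: Beaton2014RotatedHoneycomb, §3.2, Proposition 8 (arXiv:1210.0274v3 p. 15)] -/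
theorem slabMuY₂_pos {H : ℕ} (hH : 1 ≤ H) {y z : ℝ} (hy : 0 < y) (hz : 0 < z) : 0 < slabMuY₂ H y z := by
  set c : ℝ := min 1 y * min 1 z with hc
  have hc0 : 0 < c := mul_pos (lt_min one_pos hy) (lt_min one_pos hz)
  have hc1 : c ≤ 1 := by
    rw [hc]
    calc min 1 y * min 1 z ≤ 1 * 1 :=
          mul_le_mul (min_le_left _ _) (min_le_left _ _) (le_min zero_le_one hz.le) zero_le_one
      _ = 1 := one_mul 1
  have hK : 1 ≤ yK y * yK z := by nlinarith [one_le_yK y, one_le_yK z]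
  have h : c ^ 2 ≤ slabMuY₂ H y z := by
    refine le_ciInf fun n => ?_
    have h1 : c ^ (n + 1 + 1) ≤ yK y * yK z * slabZ₂ H (n + 1) y z :=
      (min_pow_le_slabZ₂ hH (n + 1) hy hz).trans (le_mul_of_one_le_left (slabZ₂_pos hH _ hy hz).le hK)
    have h2 : (c ^ (n + 1 + 1)) ^ (1 / ((n : ℝ) + 1)) ≤
        (yK y * yK z * slabZ₂ H (n + 1) y z) ^ (1 / ((n : ℝ) + 1)) :=
      Real.rpow_le_rpow (pow_nonneg hc0.le _) h1 (by positivity)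
    refine le_trans ?_ h2
    rw [← Real.rpow_natCast c (n + 1 + 1), ← Real.rpow_mul hc0.le]
    have hexp : ((n + 1 + 1 : ℕ) : ℝ) * (1 / ((n : ℝ) + 1)) ≤ 2 := by
      rw [mul_one_div, div_le_iff₀ (by positivity)]; push_cast; linarith
    calc c ^ 2 = c ^ (2 : ℝ) := by norm_cast
      _ ≤ c ^ (((n + 1 + 1 : ℕ) : ℝ) * (1 / ((n : ℝ) + 1))) := Real.rpow_le_rpow_of_exponent_ge hc0 hc1 hexp
  exact lt_of_lt_of_le (pow_pos hc0 2) h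

/-- **Proposition 8, symmetry of the growth rate: `μ_H(y,z) = μ_H(z,y)`** (from the exact symmetry of every
`Ĉ_{H,n}`). [cite: Beaton2014RotatedHoneycomb, §3.2, Proposition 8 (arXiv:1210.0274v3 p. 15: "μ_T(y,z) = μ_T(z,y)")] -/
theorem slabMuY₂_symm (H : ℕ) (y z : ℝ) : slabMuY₂ H y z = slabMuY₂ H z y := by
  unfold slabMuY₂
  simp_rw [slabZ₂_symm H _ y z, mul_comm (yK y) (yK z)]

/-- `μ_H(y,1)` is the one-variable growth rate `HexBW.slabMuY H y` of `HexSAWBrickWallSlabFugacity.lean`.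
[cite: Beaton2014RotatedHoneycomb, §3.2, Proposition 8 (arXiv:1210.0274v3 p. 15: μ_T(y,1))] -/
theorem slabMuY₂_one_right (H : ℕ) (y : ℝ) : slabMuY₂ H y 1 = slabMuY H y := by
  unfold slabMuY₂ slabMuY
  have hK : yK 1 = 1 := by simp [yK]
  simp_rw [hK, mul_one, slabZ₂_one_right]

/-- **`μ_H(1,y) = μ_H(y,1)`**: the other-side-weighted growth rate of Proposition 9 is `HexBW.slabMuY H y`.
[cite: Beaton2014RotatedHoneycomb, §3.2, Proposition 8 (arXiv:1210.0274v3 p. 15: "and so in particular μ_T(y,1) = μ_T(1,y)")] -/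
theorem slabMuY₂_one_left (H : ℕ) (z : ℝ) : slabMuY₂ H 1 z = slabMuY H z := by
  rw [slabMuY₂_symm, slabMuY₂_one_right]

end Literature.Probability.RandomPlanarGeometry.SAW.HexBW
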